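import Literature.NumberTheory.Automorphic.PairLFunctionPolesRankNeAssembly
import Literature.NumberTheory.Automorphic.PairLFunctionPolesGLOneProofs
import Literature.NumberTheory.Automorphic.AutomorphicTwistSatake
import Literature.NumberTheory.Automorphic.UnramifiedHeckeScalarsProofs
import Literature.NumberTheory.Automorphic.SummableNormSqTraceSatakePowGL2
import Literature.NumberTheory.GaloisRepresentations.HeckeCharacterRamificationProofs
import HarnessLib

/-!
# Arthur–Clozel (2.2) at `s = 1`, `n ≠ m`: ranks `≤ 2` unconditionally, and `GL_n × GL_1` by
absorption of the character into the twist (proofs only)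

Topic `NumberTheory/Automorphic`; namespace `Literature.NumberTheory.Automorphic`. Proof file
(theorems only: no definition, no named fact, no instance) under the named fact
`JacquetShalika1981_partialPairL_at_one_of_rank_ne` of `PairLFunctionPoles` — Arthur–Clozel,
*Simple algebras, base change, and the advanced theory of the trace formula*, Ann. of Math.
Stud. 120 (1989), Ch. 3 §2, (2.2), p. 171 of the held copy, at `s₀ = 1`, `n ≠ m` — in the case
`m = 1` (and `n = 1`), i.e. for the pairs `(π, χ)` of a cuspidal `π` of `GL_n(𝔸_K)` and an idele
class character `χ` (a cuspidal automorphic representation of `GL_1(𝔸_K)`).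

For such pairs the partial Rankin–Selberg `L`-function is a partial *standard* `L`-function:
`L^S(s, π × χ) = ∏_{v ∉ S} det(1 - χ(ϖ_v) t_{π,v} q_v^{-s})⁻¹ = L^S(s, π ⊗ χ)`, the twist `π ⊗ χ`
being again cuspidal on `GL_n(𝔸_K)` with Hecke matrices `t_{π ⊗ χ, v} = χ(ϖ_v) t_{π,v}`
(Arthur–Clozel, Ch. 3, p. 172; in the tree `CuspidalAutomorphicRepGL.twistByChar` of
`AutomorphicTwist` and `IsSatakeFamilyOf.twistByChar` of `AutomorphicTwistSatake`). Hence the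
one-family datum to which `PairLFunctionPolesChangeOfS` / `PairLFunctionPolesRankNeAssembly` reduced
the fact is, for `m = 1`, a statement about standard `L`-functions of cuspidal representations of
`GL_n` alone: *for every cuspidal `Π` of `GL_n(𝔸_K)`, every finite `S` and every Satake family `γ`
of `Π` off `S`, `L^S(s, Π)` has a finite non-zero limit as `s → 1`, `Re s > 1`* — (2.2) at `s₀ = 1`
for `σ = 1` (for `n ≥ 2` the set `X` is empty), in print the holomorphy of `L(s, Π)` at `s = 1`
(Godement–Jacquet, LNM 260, Thm. 13.8: entire for `n ≥ 2`) together with the non-vanishing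
`L(1, Π) ≠ 0` (Jacquet–Shalika, *A non-vanishing theorem for zeta functions of `GL_n`*, Invent.
Math. 38 (1976), Theorem p. 1). Neither is a theorem of the tree; under the fact-decomposition
discipline (D-0026) the statement is an explicit hypothesis here, not a new named fact.

Contents (all proved):

* **Ranks `≤ 2` unconditionally** (sections `LeTwo`, `TwoOne`): Jacquet–Shalika's (5.3.3)
  `summable_normSq_trace_satakePow` is a theorem of the tree in rank `≤ 2`
  (`summable_normSq_trace_satakePow_of_le_two` of `SummableNormSqTraceSatakePowGL2`: the `GL₂`
  mean-square tower; rank `≤ 1`: unit parameters), so (2.1) holds unconditionally for `n, m ≤ 2`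
  (`JacquetShalika1981_multipliable_partialPairL_of_le_two`, by
  `JacquetShalika1981_multipliable_partialPairL_of_summable`), and with Cor. (2.5) and (5.1.3) also
  theorems in rank `≤ 2` **the named fact for `n, m ≤ 2` is equivalent to its one-family datum**
  (`JacquetShalika1981_partialPairL_at_one_of_rank_ne_iff_one_family_of_le_two`,
  `…_of_one_family_of_le_two'`); for `GL₂ × GL₁` and `GL₁ × GL₂` both are equivalent to the single
  `GL₂ × GL₁` datum (`…_two_one_iff`, `…_one_two_iff`, `…_two_one_and_one_two`, by
  `partialPairL_comm`);
* `HeckeCharacter.exists_level` — **every Hecke character has a level**: for any (continuous) idele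
  class character `χ` of `K` and any `n` there is a non-zero ideal `𝔪` with `χ(det k) = 1` for all
  `k` in the principal congruence subgroup `K(𝔪) ≤ GL_n(𝔸_K)` (the `K(𝔪)` are cofinal among the
  neighbourhoods of `1`, `exists_principalCongruenceLevel_subset`; a subgroup of `ℂˣ` inside
  `{|z - 1| < 1/2}` is trivial, `HeckeCharacter.eq_one_of_norm_pow_sub_one_le` — Tate's "no small
  subgroups"); the finite-order case was `HeckeCharacter.exists_level_of_isFiniteOrder` of
  `ArthurClozelBaseChangeProofs`;
* `satakeTensor_singleton_right`, `partialPairL_eq_partialStandardL_twist` —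
  **`L^S(s, α ⊗ {χ(ϖ_v)}) = L^S(s, χ(ϖ_v) α)`**: against an honest Satake family of a cuspidal
  `χ : GL_1` (which is `v ↦ {χ(ϖ_v)}`, `IsSatakeFamilyOf.eq_singleton_valueAtUniformizer`) the
  partial pair `L`-function of any family `α` is the partial standard `L`-function of the twisted
  family;
* `exists_one_family_datum_of_standard` — **the `GL_n × GL_1` datum from the standard statement**:
  if every partial standard `L`-function of every cuspidal `Π` of `GL_n(𝔸_K)` (in `L²(μ)`) has a
  finite non-zero limit at `1` from `Re s > 1`, then every pair `(π, χ)`, `π` cuspidal of `GL_n` in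
  `L²(μ)`, `χ` cuspidal of `GL_1`, carries the one-family datum (take `S₀ ⊇` the exceptional sets of
  both and the support of a level `𝔪` of `χ`, and `Π = π ⊗ χ`);
* `JacquetShalika1981_partialPairL_at_one_of_rank_ne_two_one_and_one_two_of_standard` —
  **`GL₂ × GL₁` and `GL₁ × GL₂`, unconditionally in the tree's inputs**: the named fact for
  `(n, m) = (2, 1)` and `(1, 2)` follows from the standard statement for cuspidal representations of
  `GL₂(𝔸_K)` alone (`JacquetShalika1981_partialPairL_at_one_of_rank_ne_two_one_and_one_two`:
  (2.1), Cor. (2.5), (5.1.3) are theorems in rank `≤ 2`);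
* `JacquetShalika1981_partialPairL_at_one_of_rank_ne_of_standard_of_normLt` (`m = 1`, general `n`:
  from (2.1) at `(n, 1)`, Cor. (2.5) at `GL_n` and the standard statement),
  `JacquetShalika1981_partialPairL_at_one_of_rank_ne_of_standard_of_summable_of_normLt` (`m = 1`:
  from one-family (5.3.3)-summability at `GL_n`, Cor. (2.5) at `GL_n` and the standard statement) and
  `JacquetShalika1981_partialPairL_at_one_of_rank_ne_of_standard_of_summable_left` (`n = 1`: from
  one-family (5.3.3)-summability at `GL_m` and the standard statement at `GL_m`).

## References

* J. Arthur, L. Clozel, *Simple algebras, base change, and the advanced theory of the trace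
  formula*, Ann. of Math. Stud. 120 (1989), Ch. 3 §2, (2.2) p. 171, and p. 172 (`t_{π ⊗ η, v}`).
  [ArthurClozelAMS120]
* H. Jacquet, J. A. Shalika, *A non-vanishing theorem for zeta functions of `GL_n`*, Invent. Math.
  38 (1976), 1–16, Theorem p. 1 (`L_S(1 + it, π) ≠ 0`). [JacquetShalikaInvent1976]
* R. Godement, H. Jacquet, *Zeta functions of simple algebras*, LNM 260 (1972), Thm. 13.8.
  [GodementJacquet1972]
* J. Tate, *Fourier analysis in number fields and Hecke's zeta-functions* (1950), in
  Cassels–Fröhlich (1967), Ch. XV, Lemma 3.2.1 (no small subgroups). [TateThesis1967]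
-/

noncomputable section

open scoped MatrixGroups Topology
open NumberField IsDedekindDomain MeasureTheory Filter

namespace Literature.NumberTheory.GaloisRepresentations.HeckeCharacter

open Literature.NumberTheory.Automorphic

variable {K : Type} [Field K] [NumberField K]

/-- **Every Hecke character has a level.** For a (continuous) idele class character `χ` of `K` and
any `n` there is a non-zero ideal `𝔪 ⊆ 𝓞 K` with `χ (det k) = 1` for every `k` in the principal
congruence subgroup `K(𝔪) ≤ GL_n(𝔸_K)`: the open set `{g : |χ(det g) - 1| < 1/2}` is a
neighbourhood of `1`, so contains some `K(𝔪)` (`exists_principalCongruenceLevel_subset`), and then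
for `k ∈ K(𝔪)` all powers `χ(det k)^j = χ(det k^j)` stay within `1/2` of `1`, forcing `χ(det k) = 1`
(`eq_one_of_norm_pow_sub_one_le`, Tate's Lemma 3.2.1: a neighbourhood of `1` in `ℂˣ` containing no
non-trivial subgroup). [cite: TateThesis1967, Ch. XV, Lemma 3.2.1] -/
theorem exists_level (n : ℕ) (χ : HeckeCharacter K) :
    ∃ 𝔪 : Ideal (𝓞 K), 𝔪 ≠ 0 ∧
      ∀ k ∈ principalCongruenceLevel n K 𝔪, χ (Matrix.GeneralLinearGroup.det k) = 1 := by
  set V : Set (ideleGroup K) := {x | ‖((χ x : ℂˣ) : ℂ) - 1‖ < 1 / 2} with hV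
  have hcont : Continuous fun x : ideleGroup K => ‖((χ x : ℂˣ) : ℂ) - 1‖ :=
    ((Units.continuous_val.comp (map_continuous χ)).sub continuous_const).norm
  have hVopen : IsOpen V := isOpen_lt hcont continuous_const
  have hV1 : (1 : ideleGroup K) ∈ V := by
    simp only [hV, Set.mem_setOf_eq, map_one, Units.val_one, sub_self, norm_zero]
    norm_num
  have hU : (Matrix.GeneralLinearGroup.det : GL (Fin n) (AdeleRing (𝓞 K) K) →* ideleGroup K) ⁻¹' V ∈
      𝓝 (1 : GL (Fin n) (AdeleRing (𝓞 K) K)) :=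
    Matrix.GeneralLinearGroup.continuous_det.continuousAt.preimage_mem_nhds
      (by rw [map_one]; exact hVopen.mem_nhds hV1)
  obtain ⟨𝔪, h𝔪, hsub⟩ := exists_principalCongruenceLevel_subset n K hU
  refine ⟨𝔪, h𝔪, fun k hk => ?_⟩
  have hpow : ∀ j : ℕ, ‖((χ (Matrix.GeneralLinearGroup.det k) : ℂˣ) : ℂ) ^ j - 1‖ ≤ 1 / 2 := by
    intro j
    have hkj := hsub (pow_mem hk j : k ^ j ∈ principalCongruenceLevel n K 𝔪)
    simp only [Set.mem_preimage, hV, Set.mem_setOf_eq, map_pow, Units.val_pow_eq_pow_val] at hkj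
    exact hkj.le
  have hz := eq_one_of_norm_pow_sub_one_le (by norm_num : (1 / 2 : ℝ) < 1) hpow
  exact Units.val_eq_one.mp hz

end Literature.NumberTheory.GaloisRepresentations.HeckeCharacter

namespace Literature.NumberTheory.Automorphic

open AdelicGroupData

/-! ### `L^S(s, α ⊗ {χ(ϖ_v)}) = L^S(s, χ(ϖ_v) α)` -/

section Singleton

variable {K : Type} [Field K] [NumberField K]

/-- `α ⊗ {b} = {b a : a ∈ α}` (pair parameters against a singleton). [folklore] -/
theorem satakeTensor_singleton_right (α : Multiset ℂ) (b : ℂ) :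
    satakeTensor α {b} = α.map (b * ·) := by
  induction α using Multiset.induction_on with
  | empty => simp
  | cons a α ih =>
    rw [satakeTensor_cons_left, ih, Multiset.map_singleton, Multiset.map_cons,
      Multiset.singleton_add, mul_comm a b]

variable {μ₁ : Measure (gl 1 K).automorphicQuotient} [(gl 1 K).IsAutomorphicMeasure μ₁]

/-- **`L^S(s, α ⊗ β) = L^S(s, χ(ϖ_v) α)` for the Satake family `β` of a cuspidal `χ : GL_1`.** An
honest Satake family of a cuspidal automorphic representation `χ` of `GL_1(𝔸_K)` off `S` is
`v ↦ {χ(ϖ_v)}` (`IsSatakeFamilyOf.eq_singleton_valueAtUniformizer`, `χ = χ_{P'}` its Hecke character),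
so for any family `α` the partial pair `L`-function `L^S(s, α ⊗ β)` is the partial standard
`L`-function of the twisted family `v ↦ χ(ϖ_v) α(v)` — the family of `π ⊗ χ` when `α` is a family of
`π` (Arthur–Clozel, Ch. 3, p. 172). [cite: ArthurClozelAMS120, Ch. 3, p. 172] -/
theorem partialPairL_eq_partialStandardL_twist {P' : CuspidalAutomorphicRepGL 1 K μ₁}
    {S : Set (HeightOneSpectrum (𝓞 K))} {β : SatakeFamily K} (hβ : IsSatakeFamilyOf P' S β)
    (α : SatakeFamily K) :
    partialPairL S α β =
      partialStandardL S fun v => (α v).map (P'.heckeCharacter.valueAtUniformizer v * ·) := by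
  funext s
  rw [partialPairL_eq_partialStandardL]
  unfold partialStandardL
  refine tprod_congr fun v => ?_
  simp only [hβ.eq_singleton_valueAtUniformizer v.2, satakeTensor_singleton_right]

end Singleton

/-! ### The `GL_n × GL_1` datum from the standard statement -/

section Datum

variable {n : ℕ} {K : Type} [Field K] [NumberField K]
  {μ : Measure (gl n K).automorphicQuotient} [(gl n K).IsAutomorphicMeasure μ]
  {μ₁ : Measure (gl 1 K).automorphicQuotient} [(gl 1 K).IsAutomorphicMeasure μ₁]

/-- **The one-family datum for `GL_n × GL_1` from the standard statement at `GL_n`.** Suppose that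
for every cuspidal `Π` of `GL_n(𝔸_K)` (in `L²(μ)`), every finite `S` and every Satake family `γ` of
`Π` off `S`, `L^S(s, Π)` has a finite non-zero limit as `s → 1`, `Re s > 1` (Godement–Jacquet
holomorphy at `1` with Jacquet–Shalika's (1976) non-vanishing `L(1, Π) ≠ 0`; for `n = 1` the
hypothesis fails at `Π = 1` and the statement is vacuous in use). Then for every cuspidal `π` of
`GL_n` in `L²(μ)` and `χ` of `GL_1` in `L²(μ₁)` there are a finite `S₀`, Satake families `α₀`, `β₀`
of `π`, `χ` off `S₀` and `c ≠ 0` with `L^{S₀}(s, α₀ ⊗ β₀) → c`: take Satake families of both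
(`exists_isSatakeFamilyOf_holds`), a level `𝔪` of the Hecke character of `χ`
(`HeckeCharacter.exists_level`), `S₀` the union of the two exceptional sets and the support of
`𝔪`, and apply the hypothesis to the twist `π ⊗ χ` (`CuspidalAutomorphicRepGL.twistByChar`; its
family off `S₀` is `χ(ϖ_v) α₀(v)`, `IsSatakeFamilyOf.twistByChar`), whose partial standard
`L`-function is `L^{S₀}(s, α₀ ⊗ β₀)` (`partialPairL_eq_partialStandardL_twist`).
[cite: ArthurClozelAMS120, Ch. 3 §2 (2.2) and p. 172] -/
theorem exists_one_family_datum_of_standard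
    (hstd : ∀ (Q : CuspidalAutomorphicRepGL n K μ) {S : Set (HeightOneSpectrum (𝓞 K))}
      (_hS : S.Finite) {γ : SatakeFamily K} (_hγ : IsSatakeFamilyOf Q S γ),
      ∃ c : ℂ, c ≠ 0 ∧ Tendsto (partialStandardL S γ) (𝓝[{s : ℂ | 1 < s.re}] 1) (𝓝 c))
    (P : CuspidalAutomorphicRepGL n K μ) (P' : CuspidalAutomorphicRepGL 1 K μ₁) :
    ∃ (S₀ : Set (HeightOneSpectrum (𝓞 K))) (α₀ β₀ : SatakeFamily K), S₀.Finite ∧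
      IsSatakeFamilyOf P S₀ α₀ ∧ IsSatakeFamilyOf P' S₀ β₀ ∧
      ∃ c : ℂ, c ≠ 0 ∧ Tendsto (partialPairL S₀ α₀ β₀) (𝓝[{s : ℂ | 1 < s.re}] 1) (𝓝 c) := by
  classical
  obtain ⟨S₁, α, -, hα⟩ := exists_isSatakeFamilyOf_holds (n := n) (K := K) (μ := μ) P
  obtain ⟨S₂, β, -, hβ⟩ := exists_isSatakeFamilyOf_holds (n := 1) (K := K) (μ := μ₁) P'
  obtain ⟨𝔪, h𝔪, hχ𝔪⟩ := P'.heckeCharacter.exists_level n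
  have hT : {v : HeightOneSpectrum (𝓞 K) | v.asIdeal ∣ 𝔪}.Finite := Ideal.finite_factors h𝔪
  set S₀ : Set (HeightOneSpectrum (𝓞 K)) :=
    (↑S₁ ∪ ↑S₂) ∪ {v : HeightOneSpectrum (𝓞 K) | v.asIdeal ∣ 𝔪} with hS₀_def
  have hS₀ : S₀.Finite := (S₁.finite_toSet.union S₂.finite_toSet).union hT
  have hα₀ : IsSatakeFamilyOf P S₀ α :=
    hα.mono (Set.subset_union_left.trans Set.subset_union_left)
  have hβ₀ : IsSatakeFamilyOf P' S₀ β :=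
    hβ.mono (Set.subset_union_right.trans Set.subset_union_left)
  -- the twist `π ⊗ χ` and its Satake family `χ(ϖ_v) α(v)` off `S₀`
  have hγ := hα₀.twistByChar P'.heckeCharacter P'.isUnitary_heckeCharacter
    P'.heckeCharacter_posRealIdele h𝔪 hχ𝔪 (fun v hv hdvd => hv (Set.mem_union_right _ hdvd))
  obtain ⟨c, hc, hlim⟩ := hstd _ hS₀ hγ
  refine ⟨S₀, α, β, hS₀, hα₀, hβ₀, c, hc, ?_⟩
  rwa [partialPairL_eq_partialStandardL_twist hβ₀ α]

/-- The same datum for the pair in the other order, `(χ, π)`: `L^{S₀}(s, β₀ ⊗ α₀)`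
(`partialPairL_comm`). [cite: ArthurClozelAMS120, Ch. 3 §2 (2.2)] -/
theorem exists_one_family_datum_of_standard_left
    (hstd : ∀ (Q : CuspidalAutomorphicRepGL n K μ) {S : Set (HeightOneSpectrum (𝓞 K))}
      (_hS : S.Finite) {γ : SatakeFamily K} (_hγ : IsSatakeFamilyOf Q S γ),
      ∃ c : ℂ, c ≠ 0 ∧ Tendsto (partialStandardL S γ) (𝓝[{s : ℂ | 1 < s.re}] 1) (𝓝 c))
    (P' : CuspidalAutomorphicRepGL 1 K μ₁) (P : CuspidalAutomorphicRepGL n K μ) :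
    ∃ (S₀ : Set (HeightOneSpectrum (𝓞 K))) (β₀ α₀ : SatakeFamily K), S₀.Finite ∧
      IsSatakeFamilyOf P' S₀ β₀ ∧ IsSatakeFamilyOf P S₀ α₀ ∧
      ∃ c : ℂ, c ≠ 0 ∧ Tendsto (partialPairL S₀ β₀ α₀) (𝓝[{s : ℂ | 1 < s.re}] 1) (𝓝 c) := by
  obtain ⟨S₀, α₀, β₀, hS₀, hα₀, hβ₀, c, hc, hlim⟩ := exists_one_family_datum_of_standard hstd P P'
  exact ⟨S₀, β₀, α₀, hS₀, hβ₀, hα₀, c, hc, by rwa [partialPairL_comm S₀ β₀ α₀]⟩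

end Datum

/-! ### (2.2) at `s = 1` for `GL_n × GL_1` and `GL_1 × GL_n` from the standard statement -/

section RankOne

variable {n : ℕ} {K : Type} [Field K] [NumberField K]
  {μ : Measure (gl n K).automorphicQuotient} [(gl n K).IsAutomorphicMeasure μ]
  {μ₁ : Measure (gl 1 K).automorphicQuotient} [(gl 1 K).IsAutomorphicMeasure μ₁]

/-- **`GL_n × GL_1` from (2.1), Cor. (2.5) at `GL_n`, and the standard statement at `GL_n`**
(`JacquetShalika1981_partialPairL_at_one_of_rank_ne_of_one_family_of_normLt` with the datum
supplied by `exists_one_family_datum_of_standard`; Cor. (2.5) at `GL_1` is a theorem,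
`JacquetShalika1981_norm_lt_sqrt_of_isGeneric_of_le_one`). [cite: ArthurClozelAMS120, Ch. 3 §2 (2.2)] -/
theorem JacquetShalika1981_partialPairL_at_one_of_rank_ne_of_standard_of_normLt
    (h21 : JacquetShalika1981_multipliable_partialPairL (n := n) (m := 1) (K := K) (μ := μ)
      (μ' := μ₁))
    (hB : ∀ (v : HeightOneSpectrum (𝓞 K)) {V : Type} [AddCommGroup V] [Module ℂ V]
      (ρ : Representation ℂ (GL (Fin n) (v.adicCompletion K)) V),
      JacquetShalika1981_norm_lt_sqrt_of_isGeneric ρ)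
    (hstd : ∀ (Q : CuspidalAutomorphicRepGL n K μ) {S : Set (HeightOneSpectrum (𝓞 K))}
      (_hS : S.Finite) {γ : SatakeFamily K} (_hγ : IsSatakeFamilyOf Q S γ),
      ∃ c : ℂ, c ≠ 0 ∧ Tendsto (partialStandardL S γ) (𝓝[{s : ℂ | 1 < s.re}] 1) (𝓝 c)) :
    JacquetShalika1981_partialPairL_at_one_of_rank_ne (n := n) (m := 1) (K := K) (μ := μ)
      (μ' := μ₁) :=
  JacquetShalika1981_partialPairL_at_one_of_rank_ne_of_one_family_of_normLt h21 hB
    (fun _ _ _ _ ρ => JacquetShalika1981_norm_lt_sqrt_of_isGeneric_of_le_one le_rfl ρ)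
    fun _ _ _ P P' => exists_one_family_datum_of_standard hstd P P'

/-- **`GL_n × GL_1` from one-family (5.3.3)-summability at `GL_n`, Cor. (2.5) at `GL_n`, and the
standard statement at `GL_n`** (`JacquetShalika1981_partialPairL_at_one_of_rank_ne_of_summable_of_le_one`
with the datum supplied by `exists_one_family_datum_of_standard`).
[cite: ArthurClozelAMS120, Ch. 3 §2 (2.1)–(2.2)] [cite: JacquetShalikaAJM1981, Thm. (5.3), (5.3.3)] -/
theorem JacquetShalika1981_partialPairL_at_one_of_rank_ne_of_standard_of_summable_of_normLt
    (hsum : ∀ P : CuspidalAutomorphicRepGL n K μ, ∃ (S₀ : Finset (HeightOneSpectrum (𝓞 K)))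
      (α₀ : SatakeFamily K), (∀ v ∈ S₀, ¬ IsUnramifiedAt P.1 v) ∧ IsSatakeFamilyOf P ↑S₀ α₀ ∧
        ∀ ⦃σ : ℝ⦄, 1 < σ →
          Summable fun kv : ℕ × {v : HeightOneSpectrum (𝓞 K) // v ∉ (↑S₀ : Set _)} =>
            ‖((α₀ kv.2.1).map (· ^ (kv.1 + 1))).sum‖ ^ 2 /
              ((kv.1 + 1 : ℝ) * (kv.2.1.residueCard : ℝ) ^ ((kv.1 + 1 : ℝ) * σ)))
    (hB : ∀ (v : HeightOneSpectrum (𝓞 K)) {V : Type} [AddCommGroup V] [Module ℂ V]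
      (ρ : Representation ℂ (GL (Fin n) (v.adicCompletion K)) V),
      JacquetShalika1981_norm_lt_sqrt_of_isGeneric ρ)
    (hstd : ∀ (Q : CuspidalAutomorphicRepGL n K μ) {S : Set (HeightOneSpectrum (𝓞 K))}
      (_hS : S.Finite) {γ : SatakeFamily K} (_hγ : IsSatakeFamilyOf Q S γ),
      ∃ c : ℂ, c ≠ 0 ∧ Tendsto (partialStandardL S γ) (𝓝[{s : ℂ | 1 < s.re}] 1) (𝓝 c)) :
    JacquetShalika1981_partialPairL_at_one_of_rank_ne (n := n) (m := 1) (K := K) (μ := μ)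
      (μ' := μ₁) :=
  JacquetShalika1981_partialPairL_at_one_of_rank_ne_of_summable_of_le_one le_rfl hsum hB
    fun _ _ _ P P' => exists_one_family_datum_of_standard hstd P P'

/-- **`GL_1 × GL_n` from one-family (5.3.3)-summability at `GL_n` and the standard statement at
`GL_n`** (`JacquetShalika1981_partialPairL_at_one_of_rank_ne_of_summable_of_le_one_left` with the
datum supplied by `exists_one_family_datum_of_standard_left`; all inputs at `GL_1` are theorems).
[cite: ArthurClozelAMS120, Ch. 3 §2 (2.1)–(2.2)] [cite: JacquetShalikaAJM1981, Thm. (5.3), (5.3.3)] -/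
theorem JacquetShalika1981_partialPairL_at_one_of_rank_ne_of_standard_of_summable_left
    (hsum : ∀ P : CuspidalAutomorphicRepGL n K μ, ∃ (S₀ : Finset (HeightOneSpectrum (𝓞 K)))
      (α₀ : SatakeFamily K), (∀ v ∈ S₀, ¬ IsUnramifiedAt P.1 v) ∧ IsSatakeFamilyOf P ↑S₀ α₀ ∧
        ∀ ⦃σ : ℝ⦄, 1 < σ →
          Summable fun kv : ℕ × {v : HeightOneSpectrum (𝓞 K) // v ∉ (↑S₀ : Set _)} =>
            ‖((α₀ kv.2.1).map (· ^ (kv.1 + 1))).sum‖ ^ 2 /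
              ((kv.1 + 1 : ℝ) * (kv.2.1.residueCard : ℝ) ^ ((kv.1 + 1 : ℝ) * σ)))
    (hstd : ∀ (Q : CuspidalAutomorphicRepGL n K μ) {S : Set (HeightOneSpectrum (𝓞 K))}
      (_hS : S.Finite) {γ : SatakeFamily K} (_hγ : IsSatakeFamilyOf Q S γ),
      ∃ c : ℂ, c ≠ 0 ∧ Tendsto (partialStandardL S γ) (𝓝[{s : ℂ | 1 < s.re}] 1) (𝓝 c)) :
    JacquetShalika1981_partialPairL_at_one_of_rank_ne (n := 1) (m := n) (K := K) (μ := μ₁)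
      (μ' := μ) :=
  JacquetShalika1981_partialPairL_at_one_of_rank_ne_of_summable_of_le_one_left le_rfl hsum
    fun _ _ _ P' P => exists_one_family_datum_of_standard_left hstd P' P

end RankOne

/-! ### Ranks `≤ 2` unconditionally: the fact is equivalent to its one-family datum -/

section LeTwo

variable {n m : ℕ} {K : Type} [Field K] [NumberField K]
  {μ : Measure (gl n K).automorphicQuotient} [(gl n K).IsAutomorphicMeasure μ]
  {μ' : Measure (gl m K).automorphicQuotient} [(gl m K).IsAutomorphicMeasure μ']

/-- **Arthur–Clozel (2.1) (`JacquetShalika1981_multipliable_partialPairL`) holds unconditionally in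
ranks `n, m ≤ 2`**: Jacquet–Shalika's (5.3.3) `summable_normSq_trace_satakePow` is a theorem of the
tree in rank `≤ 2` (`summable_normSq_trace_satakePow_of_le_two` of `SummableNormSqTraceSatakePowGL2`:
the `GL₂` mean-square tower; rank `≤ 1`: unit parameters), at `n` and at `m`, and (2.1) follows by
Cauchy–Schwarz (`JacquetShalika1981_multipliable_partialPairL_of_summable`, loc. cit. Thm. (5.3)).
[cite: ArthurClozelAMS120, Ch. 3 §2 (2.1)] [cite: JacquetShalikaAJM1981, Thm. (5.3)] -/
theorem JacquetShalika1981_multipliable_partialPairL_of_le_two (hn : n ≤ 2) (hm : m ≤ 2) :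
    JacquetShalika1981_multipliable_partialPairL (n := n) (m := m) (K := K) (μ := μ) (μ' := μ') :=
  JacquetShalika1981_multipliable_partialPairL_of_summable
    (summable_normSq_trace_satakePow_of_le_two hn) (summable_normSq_trace_satakePow_of_le_two hm)

/-- **In ranks `n, m ≤ 2` the named fact (2.2), `n ≠ m`, `s₀ = 1`, is equivalent to its one-family
datum, unconditionally**: all standing inputs of
`JacquetShalika1981_partialPairL_at_one_of_rank_ne_iff_one_family` — (2.1)
(`JacquetShalika1981_multipliable_partialPairL_of_le_two`), the strict bound at `GL_n`
(`norm_satakeParameter_lt_sqrt_of_le_two`) and (5.1.3) at `GL_m`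
(`norm_satakeParameter_le_sqrt_of_le_two`) — are theorems of the tree in these ranks. The only
non-vacuous cases are `GL₂ × GL₁` and `GL₁ × GL₂`. [cite: ArthurClozelAMS120, Ch. 3 §2 (2.2)] -/
theorem JacquetShalika1981_partialPairL_at_one_of_rank_ne_iff_one_family_of_le_two (hn : n ≤ 2)
    (hm : m ≤ 2) :
    JacquetShalika1981_partialPairL_at_one_of_rank_ne (n := n) (m := m) (K := K) (μ := μ)
        (μ' := μ') ↔
      ∀ (_hnm : n ≠ m) (_hn : 0 < n) (_hm : 0 < m) (P : CuspidalAutomorphicRepGL n K μ)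
        (P' : CuspidalAutomorphicRepGL m K μ'),
        ∃ (S₀ : Set (HeightOneSpectrum (𝓞 K))) (α₀ β₀ : SatakeFamily K), S₀.Finite ∧
          IsSatakeFamilyOf P S₀ α₀ ∧ IsSatakeFamilyOf P' S₀ β₀ ∧
          ∃ c : ℂ, c ≠ 0 ∧ Tendsto (partialPairL S₀ α₀ β₀) (𝓝[{s : ℂ | 1 < s.re}] 1) (𝓝 c) :=
  JacquetShalika1981_partialPairL_at_one_of_rank_ne_iff_one_family
    (JacquetShalika1981_multipliable_partialPairL_of_le_two hn hm)
    (fun P _ _ hα _ hv _ ha => norm_satakeParameter_lt_sqrt_of_le_two hn P hα hv ha)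
    (norm_satakeParameter_le_sqrt_of_le_two hm)

/-- **Ranks `n, m ≤ 2`: the fact from the one-family datum alone** (the `←` direction of
`JacquetShalika1981_partialPairL_at_one_of_rank_ne_iff_one_family_of_le_two`).
[cite: ArthurClozelAMS120, Ch. 3 §2 (2.2)] -/
theorem JacquetShalika1981_partialPairL_at_one_of_rank_ne_of_one_family_of_le_two' (hn : n ≤ 2)
    (hm : m ≤ 2)
    (hone : ∀ (_hnm : n ≠ m) (_hn : 0 < n) (_hm : 0 < m) (P : CuspidalAutomorphicRepGL n K μ)
      (P' : CuspidalAutomorphicRepGL m K μ'),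
      ∃ (S₀ : Set (HeightOneSpectrum (𝓞 K))) (α₀ β₀ : SatakeFamily K), S₀.Finite ∧
        IsSatakeFamilyOf P S₀ α₀ ∧ IsSatakeFamilyOf P' S₀ β₀ ∧
        ∃ c : ℂ, c ≠ 0 ∧ Tendsto (partialPairL S₀ α₀ β₀) (𝓝[{s : ℂ | 1 < s.re}] 1) (𝓝 c)) :
    JacquetShalika1981_partialPairL_at_one_of_rank_ne (n := n) (m := m) (K := K) (μ := μ)
      (μ' := μ') :=
  (JacquetShalika1981_partialPairL_at_one_of_rank_ne_iff_one_family_of_le_two hn hm).mpr hone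

end LeTwo

section TwoOne

variable {K : Type} [Field K] [NumberField K]
  {μ₂ : Measure (gl 2 K).automorphicQuotient} [(gl 2 K).IsAutomorphicMeasure μ₂]
  {μ₁ : Measure (gl 1 K).automorphicQuotient} [(gl 1 K).IsAutomorphicMeasure μ₁]

/-- **`GL₂ × GL₁`, unconditionally: the fact is equivalent to the datum** — for every cuspidal
`π` of `GL₂(𝔸_K)` and `χ` of `GL₁(𝔸_K)`, one finite `S₀`, Satake families `α₀`, `β₀` off `S₀`
and a finite non-zero limit at `s = 1` from `Re s > 1` of `L^{S₀}(s, α₀ ⊗ β₀) = L^{S₀}(s, π ⊗ χ)`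
(holomorphy and non-vanishing at `1` of the twisted standard `L`-function of `GL₂`: Jacquet–Langlands
(1970), Thm. 11.1; Jacquet–Shalika (1976)). [cite: ArthurClozelAMS120, Ch. 3 §2 (2.2)] -/
theorem JacquetShalika1981_partialPairL_at_one_of_rank_ne_two_one_iff :
    JacquetShalika1981_partialPairL_at_one_of_rank_ne (n := 2) (m := 1) (K := K) (μ := μ₂)
        (μ' := μ₁) ↔
      ∀ (P : CuspidalAutomorphicRepGL 2 K μ₂) (P' : CuspidalAutomorphicRepGL 1 K μ₁),
        ∃ (S₀ : Set (HeightOneSpectrum (𝓞 K))) (α₀ β₀ : SatakeFamily K), S₀.Finite ∧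
          IsSatakeFamilyOf P S₀ α₀ ∧ IsSatakeFamilyOf P' S₀ β₀ ∧
          ∃ c : ℂ, c ≠ 0 ∧ Tendsto (partialPairL S₀ α₀ β₀) (𝓝[{s : ℂ | 1 < s.re}] 1) (𝓝 c) := by
  rw [JacquetShalika1981_partialPairL_at_one_of_rank_ne_iff_one_family_of_le_two le_rfl one_le_two]
  exact ⟨fun h P P' => h (by decide) two_pos one_pos P P', fun h _ _ _ P P' => h P P'⟩

/-- **`GL₁ × GL₂`, unconditionally: the fact is equivalent to the datum for the pairs `(χ, π)`**,
and by the symmetry `L^{S₀}(s, β₀ ⊗ α₀) = L^{S₀}(s, α₀ ⊗ β₀)` (`partialPairL_comm`) that datum is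
the `GL₂ × GL₁` datum of `JacquetShalika1981_partialPairL_at_one_of_rank_ne_two_one_iff` with the
roles of the two `L²` spaces exchanged. [cite: ArthurClozelAMS120, Ch. 3 §2 (2.2)] -/
theorem JacquetShalika1981_partialPairL_at_one_of_rank_ne_one_two_iff :
    JacquetShalika1981_partialPairL_at_one_of_rank_ne (n := 1) (m := 2) (K := K) (μ := μ₁)
        (μ' := μ₂) ↔
      ∀ (P : CuspidalAutomorphicRepGL 2 K μ₂) (P' : CuspidalAutomorphicRepGL 1 K μ₁),
        ∃ (S₀ : Set (HeightOneSpectrum (𝓞 K))) (α₀ β₀ : SatakeFamily K), S₀.Finite ∧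
          IsSatakeFamilyOf P S₀ α₀ ∧ IsSatakeFamilyOf P' S₀ β₀ ∧
          ∃ c : ℂ, c ≠ 0 ∧ Tendsto (partialPairL S₀ α₀ β₀) (𝓝[{s : ℂ | 1 < s.re}] 1) (𝓝 c) := by
  rw [JacquetShalika1981_partialPairL_at_one_of_rank_ne_iff_one_family_of_le_two one_le_two le_rfl]
  constructor
  · intro h P P'
    obtain ⟨S₀, β₀, α₀, hS₀, hβ₀, hα₀, c, hc, hlim⟩ := h (by decide) one_pos two_pos P' P
    exact ⟨S₀, α₀, β₀, hS₀, hα₀, hβ₀, c, hc, by rwa [partialPairL_comm S₀ α₀ β₀]⟩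
  · intro h _ _ _ P' P
    obtain ⟨S₀, α₀, β₀, hS₀, hα₀, hβ₀, c, hc, hlim⟩ := h P P'
    exact ⟨S₀, β₀, α₀, hS₀, hβ₀, hα₀, c, hc, by rwa [partialPairL_comm S₀ β₀ α₀]⟩

/-- **Both orders at once**: the `GL₂ × GL₁` datum gives the named fact for `(n, m) = (2, 1)` and
for `(n, m) = (1, 2)`. [cite: ArthurClozelAMS120, Ch. 3 §2 (2.2)] -/
theorem JacquetShalika1981_partialPairL_at_one_of_rank_ne_two_one_and_one_two
    (hone : ∀ (P : CuspidalAutomorphicRepGL 2 K μ₂) (P' : CuspidalAutomorphicRepGL 1 K μ₁),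
      ∃ (S₀ : Set (HeightOneSpectrum (𝓞 K))) (α₀ β₀ : SatakeFamily K), S₀.Finite ∧
        IsSatakeFamilyOf P S₀ α₀ ∧ IsSatakeFamilyOf P' S₀ β₀ ∧
        ∃ c : ℂ, c ≠ 0 ∧ Tendsto (partialPairL S₀ α₀ β₀) (𝓝[{s : ℂ | 1 < s.re}] 1) (𝓝 c)) :
    JacquetShalika1981_partialPairL_at_one_of_rank_ne (n := 2) (m := 1) (K := K) (μ := μ₂)
        (μ' := μ₁) ∧
      JacquetShalika1981_partialPairL_at_one_of_rank_ne (n := 1) (m := 2) (K := K) (μ := μ₁)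
        (μ' := μ₂) :=
  ⟨JacquetShalika1981_partialPairL_at_one_of_rank_ne_two_one_iff.mpr hone,
    JacquetShalika1981_partialPairL_at_one_of_rank_ne_one_two_iff.mpr hone⟩

end TwoOne

/-! ### `GL₂ × GL₁` and `GL₁ × GL₂` from the standard statement for `GL₂` alone -/

section Two

variable {K : Type} [Field K] [NumberField K]
  {μ₂ : Measure (gl 2 K).automorphicQuotient} [(gl 2 K).IsAutomorphicMeasure μ₂]
  {μ₁ : Measure (gl 1 K).automorphicQuotient} [(gl 1 K).IsAutomorphicMeasure μ₁]

/-- **Arthur–Clozel (2.2) at `s = 1` for `GL₂ × GL₁` and `GL₁ × GL₂` from the standard statement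
for `GL₂` alone.** If for every cuspidal automorphic representation `Π` of `GL₂(𝔸_K)` (in
`L²(μ₂)`), every finite `S` and every Satake family `γ` of `Π` off `S` the partial standard
`L`-function `L^S(s, Π)` has a finite non-zero limit as `s → 1`, `Re s > 1` — holomorphy at `1`
(Jacquet–Langlands (1970), Thm. 11.1; Godement–Jacquet) and non-vanishing `L(1, Π) ≠ 0`
(Jacquet–Shalika (1976)) — then the named fact `JacquetShalika1981_partialPairL_at_one_of_rank_ne`
holds for `(n, m) = (2, 1)` and for `(n, m) = (1, 2)`: every other input ((2.1), Cor. (2.5),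
(5.1.3)) is a theorem of the tree in rank `≤ 2`
(`JacquetShalika1981_partialPairL_at_one_of_rank_ne_two_one_and_one_two`), and the one-family datum
is `exists_one_family_datum_of_standard`. [cite: ArthurClozelAMS120, Ch. 3 §2 (2.2)]
[cite: JacquetShalikaInvent1976, Theorem p. 1] -/
theorem JacquetShalika1981_partialPairL_at_one_of_rank_ne_two_one_and_one_two_of_standard
    (hstd : ∀ (Q : CuspidalAutomorphicRepGL 2 K μ₂) {S : Set (HeightOneSpectrum (𝓞 K))}
      (_hS : S.Finite) {γ : SatakeFamily K} (_hγ : IsSatakeFamilyOf Q S γ),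
      ∃ c : ℂ, c ≠ 0 ∧ Tendsto (partialStandardL S γ) (𝓝[{s : ℂ | 1 < s.re}] 1) (𝓝 c)) :
    JacquetShalika1981_partialPairL_at_one_of_rank_ne (n := 2) (m := 1) (K := K) (μ := μ₂)
        (μ' := μ₁) ∧
      JacquetShalika1981_partialPairL_at_one_of_rank_ne (n := 1) (m := 2) (K := K) (μ := μ₁)
        (μ' := μ₂) :=
  JacquetShalika1981_partialPairL_at_one_of_rank_ne_two_one_and_one_two
    fun P P' => exists_one_family_datum_of_standard hstd P P'

end Two

end Literature.NumberTheory.Automorphic
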